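import Literature.Computability.Cryptography.PQCWave0
import Literature.Algebra.EuclideanLattices.SuccessiveMinima
import Literature.Algebra.EuclideanLattices.IntegerBases
import Literature.Algebra.EuclideanLattices.Encoding
import Literature.Algebra.EuclideanLattices.LLL
import HarnessLib

-- provenance: harness21/H21/H21/Statements/PQC/LLL.lean @ 42d0886 (interim HEAD d8f2665); M5 mechanical rewrite
/-!
# The LLL theorem (pqc.S15)

Family: PQC (post-quantum cryptography), trunk Lattice; item `PQCLLL` of the Lattice outline.

We state the main results of A. K. Lenstra, H. W. Lenstra Jr., L. Lovász, *Factoring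
polynomials with rational coefficients*, Math. Ann. 261 (1982), 515–534 (LLL82), §1, for an
LLL-reduced basis `b = (b₀, …, bₙ₋₁)` (parameter `δ = 3/4`, LLL82 (1.4)–(1.5); predicate
`Literature.Algebra.EuclideanLattices.IsLLLReduced` of `Literature.Prelude.Lattice.LLL`) of a lattice `L = ∑ᵢ ℤ bᵢ` in a
finite-dimensional real inner product space `E`:

* Prop. 1.6: `∏ᵢ ‖bᵢ‖ ≤ 2^{n(n-1)/4} d(L)` (1.8) and `‖b₀‖ ≤ 2^{(n-1)/4} d(L)^{1/n}` (1.9);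
* Prop. 1.11: `‖b₀‖² ≤ 2^{n-1} λ₁(L)²`;
* Prop. 1.12: `‖bⱼ‖² ≤ 2^{n-1} λᵢ₊₁(L)²` for `j ≤ i` (0-indexed; LLL82 states it with
  `max(‖x₁‖², …, ‖xₜ‖²)` over any `t` linearly independent lattice vectors, which is equivalent to
  the successive-minimum form since the ball of radius `λₜ(L)` contains `t` linearly independent
  lattice vectors);
* Prop. 1.26 (algorithmic part): there is a polynomial-time algorithm that, given an integer basis
  `B ∈ ℤⁿˣⁿ` with `det B ≠ 0`, outputs a basis `B'` of the same lattice that is LLL-reduced.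

Mathlib/H21 notions used (searched, not redefined): `Module.Basis`, `ZLattice.covolume` (the
lattice determinant `d(L)`, with the canonical Lebesgue volume `measureSpaceOfInnerProductSpace`),
`Turing.TM2ComputableInPolyTime`; `Literature.PQC.latticeOfBasis b = span ℤ (range b)` (Wave0, pqc.S10;
Mathlib gives its `DiscreteTopology`/`IsZLattice` instances), `Literature.Algebra.EuclideanLattices.minNorm` (`λ₁`),
`Literature.Algebra.EuclideanLattices.successiveMinimum` (`λᵢ`), `Literature.Algebra.EuclideanLattices.LatticeInstance` with `.encode`, `.lattice`,
`.vec`, `.IsNonsingular`, and `Literature.Algebra.EuclideanLattices.IsLLLReduced`. Mathlib has no LLL statement (searched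
`LLL`, `Lovasz`, `lattice reduction`).

Design choices:
* The basis is a `b : Basis (Fin n) ℝ E` (rather than a linearly independent family with
  `finrank ℝ E = n`; same content), so that `L := latticeOfBasis b` is a full-rank `ℤ`-lattice by
  instance and `ZLattice.covolume L` typechecks. `n ≠ 0` is assumed where `b₀` is mentioned.
* Real exponents `n(n-1)/4`, `(n-1)/4`, `1/n` use `Real.rpow` with `n` cast to `ℝ` (no natural
  subtraction); the exponent `n - 1 : ℕ` in Props. 1.11–1.12 is under the hypothesis `n ≠ 0`
  resp. `Fin n` inhabited, so it is the honest predecessor.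
* Prop. 1.26 is stated in Σ-form on the type `LatticeInstance = Σ n, ℤⁿˣⁿ` of all dimensions,
  since `TM2ComputableInPolyTime` needs one input/output type; the machine is only constrained on
  nonsingular inputs (LLL82 assumes a basis). The theorem lives in namespace `Literature.PQC`; the four
  geometric statements are dot-notation lemmas on `Literature.Algebra.EuclideanLattices.IsLLLReduced` (an H21 namespace).
-/

noncomputable section

open Module MeasureTheory Literature.Algebra.EuclideanLattices

namespace Literature.Algebra.EuclideanLattices.IsLLLReduced

variable {E : Type*} [NormedAddCommGroup E] [InnerProductSpace ℝ E] [FiniteDimensional ℝ E]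
  [MeasurableSpace E] [BorelSpace E] {n : ℕ}

/-- **pqc.S15** (LLL82, Prop. 1.6 (1.8)). If `b₀, …, bₙ₋₁` is an LLL-reduced basis (δ = 3/4) of
the lattice `L = ∑ ℤ bᵢ` in an `n`-dimensional Euclidean space, then
`∏ᵢ ‖bᵢ‖ ≤ 2^{n(n-1)/4} d(L)`, where `d(L)` is the determinant (covolume) of `L`.
Ref: Lenstra–Lenstra–Lovász, Math. Ann. 261 (1982), Prop. 1.6.
[cite: LenstraLenstraLovasz1982, Prop. 1.6 (1.8)] -/
def prod_norm_le : Prop :=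
  ∀ (b : Basis (Fin n) ℝ E) (h : IsLLLReduced (3 / 4) ⇑b),
    ∏ i, ‖b i‖ ≤ 2 ^ ((n : ℝ) * (n - 1) / 4) * ZLattice.covolume (Literature.Computability.Cryptography.latticeOfBasis b)

/-- **pqc.S15** (LLL82, Prop. 1.6 (1.9)). If `b₀, …, bₙ₋₁` (`n ≥ 1`) is an LLL-reduced basis
(δ = 3/4) of the lattice `L = ∑ ℤ bᵢ` in an `n`-dimensional Euclidean space, then
`‖b₀‖ ≤ 2^{(n-1)/4} d(L)^{1/n}`.
Ref: Lenstra–Lenstra–Lovász, Math. Ann. 261 (1982), Prop. 1.6.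
[cite: LenstraLenstraLovasz1982, Prop. 1.6 (1.9)] -/
def norm_zero_le_covolume_rpow : Prop :=
  ∀ (b : Basis (Fin n) ℝ E) (h : IsLLLReduced (3 / 4) ⇑b) (hn : n ≠ 0),
    ‖b ⟨0, Nat.pos_of_ne_zero hn⟩‖ ≤
      2 ^ (((n : ℝ) - 1) / 4) * ZLattice.covolume (Literature.Computability.Cryptography.latticeOfBasis b) ^ (1 / (n : ℝ))

/-- **pqc.S15** (LLL82, Prop. 1.11). If `b₀, …, bₙ₋₁` (`n ≥ 1`) is an LLL-reduced basis
(δ = 3/4) of the lattice `L = ∑ ℤ bᵢ` in a Euclidean space, then `‖b₀‖² ≤ 2^{n-1} λ₁(L)²`, i.e.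
`‖b₀‖² ≤ 2^{n-1} ‖x‖²` for every nonzero `x ∈ L`.
Ref: Lenstra–Lenstra–Lovász, Math. Ann. 261 (1982), Prop. 1.11.
[cite: LenstraLenstraLovasz1982, Prop. 1.11] -/
def norm_zero_sq_le_two_pow_mul_minNorm_sq : Prop :=
  ∀ (b : Basis (Fin n) ℝ E) (h : IsLLLReduced (3 / 4) ⇑b) (hn : n ≠ 0),
    ‖b ⟨0, Nat.pos_of_ne_zero hn⟩‖ ^ 2 ≤
      2 ^ (n - 1) * minNorm (Literature.Computability.Cryptography.latticeOfBasis b) ^ 2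

/-- **pqc.S15** (LLL82, Prop. 1.12). If `b₀, …, bₙ₋₁` is an LLL-reduced basis (δ = 3/4) of the
lattice `L = ∑ ℤ bᵢ` in a Euclidean space, then `‖bⱼ‖² ≤ 2^{n-1} λᵢ₊₁(L)²` for all
`j ≤ i < n` (0-indexed). LLL82 phrases this as `‖bⱼ‖² ≤ 2^{n-1} max(‖x₁‖², …, ‖xₜ‖²)` for
`j ≤ t` (1-indexed) and any `t` linearly independent `x₁, …, xₜ ∈ L`.
Ref: Lenstra–Lenstra–Lovász, Math. Ann. 261 (1982), Prop. 1.12.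
[cite: LenstraLenstraLovasz1982, Prop. 1.12] -/
def norm_sq_le_two_pow_mul_successiveMinimum_sq : Prop :=
  ∀ (b : Basis (Fin n) ℝ E) (h : IsLLLReduced (3 / 4) ⇑b) (i j : Fin n) (hji : j ≤ i),
    ‖b j‖ ^ 2 ≤ 2 ^ (n - 1) * successiveMinimum (Literature.Computability.Cryptography.latticeOfBasis b) ((i : ℕ) + 1) ^ 2

end Literature.Algebra.EuclideanLattices.IsLLLReduced

namespace Literature.Algebra.EuclideanLattices

/-- **pqc.S15** (LLL82, Prop. 1.26, algorithmic LLL). There is a polynomial-time algorithm (a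
`Turing.TM2ComputableInPolyTime` function on bit-encoded lattice instances,
`Literature.Algebra.EuclideanLattices.LatticeInstance.encode`) which, given an integer basis `B ∈ ℤⁿˣⁿ` with `det B ≠ 0`,
outputs an integer basis `B' ∈ ℤⁿˣⁿ` of the same lattice, `L(B') = L(B)`, whose rows form an
LLL-reduced basis with `δ = 3/4`. (LLL82 bounds the running time by `O(n⁴ log M)` arithmetic
operations on `O(n log M)`-bit integers, `M = max ‖bᵢ‖²`; here only polynomiality in the input
length is asserted. On singular inputs the output is unconstrained.)
Ref: Lenstra–Lenstra–Lovász, Math. Ann. 261 (1982), Prop. 1.26.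
[cite: LenstraLenstraLovasz1982, Prop. 1.26] -/
def lll_polyTime : Prop :=
  ∃ f : LatticeInstance → LatticeInstance,
      Nonempty (Turing.TM2ComputableInPolyTime LatticeInstance.encode LatticeInstance.encode f) ∧
      ∀ I : LatticeInstance, I.IsNonsingular →
        ∃ B' : Matrix (Fin I.n) (Fin I.n) ℤ, f I = ⟨I.n, B'⟩ ∧
          (⟨I.n, B'⟩ : LatticeInstance).lattice = I.lattice ∧
          IsLLLReduced (3 / 4) (LatticeInstance.vec ⟨I.n, B'⟩)

end Literature.Algebra.EuclideanLattices
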